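import Literature.NumberTheory.Automorphic.ArchLocalTorusOrbitalBlockSmooth   -- ★ p842196 (A1) F0P3a-p05 (g12): `contDiffAt_integral_comp_of_contDiff_of_support` (pattern), `exists_closedBall_isCompact_apply_conj_circleDiagonal_angles_eq_zero_of_blocks`; brings ★ Hörmander `iteratedFDeriv_integral_eq`, ★ (C-cw)
import Literature.NumberTheory.Automorphic.ArchTorusOrbitalWeyl               -- ★ F0P3a-p06: `integral_comp_conj_circleDiagonal_comp_perm` (Weyl moves, every `z`), `integral_comp_conj_conj`
import HarnessLib

/-!
# ROAD A (A2′) — THE COMPACT TRANSVERSAL EXPANSION AT A COMPACT WALL of `G_w = U(σ_w diag α)(ℂ)`: derivatives of the torus orbital function UNDER the integral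
# along lines of angles, EVENNESS across a compact wall (odd normal derivatives vanish), and «all transversal second derivatives are the normal one»
# (Rogawski 1990 §8.2 pp. 122–123, §8.4 p. 126; Harish-Chandra's limit formula at the centre of `U(2,1)`, in-house road (A1)–(A5))

Topic `NumberTheory/Automorphic`; namespaces `Literature.Analysis.Calculus` (§0, generic) and `Literature.NumberTheory.Automorphic.UnitaryGroup` (§1–§3).  THEOREMS ONLY (no `def`, no
instance, no notation, no axiom, no named fact, no `sorry`).  Cell `pub/hodgecm-mathlib`, ENGINE T1 (crux H413 = `stmt-HodgeConjecture-24833`); ROAD-Sd line «SdArch», its one printed-hard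
stub N1 `stub_ArchCentralLimitU21 : ArchCentralLimitFormulaRankTwo` (★ p842205), ROAD A of the R4 maps (F0P3a-p03 c3af6e58 ∕ 934e0f7c) as re-priced by A-p14 (g28)'s N1 COST CENSUS
(dd43a5a76e2ab9d6, chair F0P3a-plan (g10) WORDS T9-1 (3) ∕ T9-3 (3)): brick **(A2′) «COMPACT TRANSVERSAL EXPANSION»** replacing g10's (A2) «radial Casimir on `U(2,1)`»; author A-p14 (g28);
owner of ROAD A = F0P3a-p05 lineage ((A1) ★ p842196, (A1′), (A3) his).

THE MATHEMATICS.  Per place, `G_w = archLocal L N (diagonal α) w` (any `N`, any signature, real non-zero weights `e_i = re σ_w(α_i)`), `Φ_Θ(θ) := ∫_{G_w} Θ(g·diag(ζ_k e^{iθ_k})·g⁻¹) dν(g)` the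
torus orbital function of angles `θ` at a base point `ζ`, `Θ` smooth on `M_N(ℂ)` with compact support on `G_w`, `ν` finite on compacts (right-invariant where stated).
* §0 (generic; the FORMULA companion of ★ (A1)'s `contDiffAt_integral_comp_of_contDiff_of_support`): for `Ψ : P × ℝ → F` smooth, `y : Y → P` continuous and a UNIFORM compact support near
  `s₀` (`Ψ(y t, s) = 0` for `t ∉ S` compact, `s` near `s₀`), every iterated derivative passes under the integral:
  `iteratedDeriv n (s ↦ ∫ Ψ(y t, s) dμ) s₀ = ∫ iteratedDeriv n (s ↦ Ψ(y t, s)) s₀ dμ` (★ Hörmander `iteratedFDeriv_integral_eq` after the same smooth cutoff as (A1)).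
* §1 **DERIVATIVES UNDER THE INTEGRAL ALONG A LINE OF ANGLES** at a block-separated `θ₀` (labelling `b` of constant sign on each block, coincidences allowed INSIDE blocks — so
  THROUGH every compact wall): `∂ⁿ_y|₀ Φ_Θ(θ₀ + y·v) = ∫_{G_w} ∂ⁿ_y|₀ Θ(g·diag(ζ e^{i(θ₀+yv)})·g⁻¹) dν` for every direction `v` and every order `n` (§0 + ★ (C-cw) uniform support); and the
  same with the whole curve CONJUGATED by a fixed `u ∈ G_w` — the integral does not see `u` (★ `integral_comp_conj_conj`): for `u = m ∈ Z(diag ζe^{iθ₀})` these are the derivatives along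
  ALL the `Ad(m)`-conjugates of the torus direction, i.e. along every direction transversal to the wall inside the compact centraliser `M = U(2)×U(1)` — «ALL TRANSVERSAL DERIVATIVES AT A
  COMPACT-WALL POINT ARE THE NORMAL ONES» (this is what replaces the radial-component computation of the Casimir on the noncompact group: on averaging over `m ∈ M` the integrand
  becomes a class function on the singular orbit `G_w∕M`, the input shape of (A3)'s hat-box — see (A3)).
* §2 **EVENNESS ACROSS A COMPACT WALL**: at a wall point (`ζ_i = ζ_j` for a COMPACT pair `e_i e_j > 0`) the normal line `θ = y(δ_i − δ_j)` satisfies `Φ_Θ(−y) = Φ_Θ(y)` — the block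
  Weyl element of ★ `integral_comp_conj_circleDiagonal_comp_perm` (sign-preserving transposition `(i j)`, EVERY `z`) swaps the two angles; hence EVERY ODD normal derivative of `Φ_Θ`
  vanishes at the wall (`iteratedDeriv_comp_neg`), in particular `NΦ|_{wall} = N³Φ|_{wall} = 0`, and with §1 `N²Φ|_{wall} = ∫_{G_w} ∂²_y|₀ Θ(g·diag(ζe^{iy(δ_i−δ_j)})·g⁻¹) dν`.
  With `F := ρ′Δ·Φ` this is the input of g10's wall identity `ωF|_{wall} = 2A²(NF) + 2N³F`, `N³F|_{wall} = ρ[3(N′Δ)N²Φ + (N³′Δ)Φ]` ((A4)'s Leibniz step; not repeated here).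
HONEST LABEL: HC_CM is proved only modulo the printed citations until rung 0 closes; this file is parametric calculus + one Weyl move and pays no printed statement.

## References
* [Rogawski1990] J. D. Rogawski, *Automorphic Representations of Unitary Groups in Three Variables*, Ann. of Math. Stud. 123 (1990), §8.2 pp. 122–123 (the compact wall `γ₂ → γ₀′`,
  centraliser `U(2) × U(1)`), §8.4 p. 126 (`ω = ∏(∂_i − ∂_j)` at the centre).
* [HormanderALPDO1] L. Hörmander, *The Analysis of Linear Partial Differential Operators I*, Thm. 1.1.9 (differentiation under the integral sign).
* [Varadarajan1989] V. S. Varadarajan, *An Introduction to Harmonic Analysis on Semisimple Lie Groups* (1989), §2.4 Thm. 8 (smoothness of orbital integrals on the regular set).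
* [BrockerTomDieck1985] Th. Bröcker, T. tom Dieck, *Representations of Compact Lie Groups*, Ch. IV (3.2) (Weyl group of `U(n)` as permutations of the torus).
-/

set_option autoImplicit false

noncomputable section

open MeasureTheory Measure Filter Topology Set Function Metric NumberField NumberField.InfinitePlace
open scoped ContDiff

/-! ## §0 Generic: iterated derivatives of a one-parameter integral with uniform compact support pass under the integral -/

namespace Literature.Analysis.Calculus

section Generic

variable {Y : Type*} [TopologicalSpace Y] [T2Space Y] [MeasurableSpace Y] [OpensMeasurableSpace Y]
  {P : Type*} [NormedAddCommGroup P] [NormedSpace ℝ P]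
  {F : Type*} [NormedAddCommGroup F] [NormedSpace ℝ F] [CompleteSpace F]

/-- **ITERATED DIFFERENTIATION UNDER THE INTEGRAL SIGN, UNIFORM COMPACT SUPPORT, ONE REAL PARAMETER**: `μ` finite on compacts, `Ψ : P × ℝ → F` smooth, `y : Y → P` continuous; if
`Ψ(y t, s) = 0` for `t ∉ S` (`S` compact) and `s ∈ U ∈ 𝓝 s₀`, then `∂ⁿ_s|_{s₀} ∫_Y Ψ(y t, s) dμ(t) = ∫_Y ∂ⁿ_s|_{s₀} Ψ(y t, s) dμ(t)` for every `n`.  (Same smooth cutoff `χ = 1` near `s₀`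
as ★ `contDiffAt_integral_comp_of_contDiff_of_support`; then ★ `iteratedFDeriv_integral_eq` (Hörmander) for the cut integrand, whose derivatives at `s₀` are the uncut ones, and
evaluation of the multilinear integral at `(1, …, 1)`.) [cite: HormanderALPDO1, Thm. 1.1.9] -/
theorem iteratedDeriv_integral_comp_of_contDiff_of_support (μ : Measure Y) [IsFiniteMeasureOnCompacts μ] (Ψ : P × ℝ → F) (hΨ : ContDiff ℝ ∞ Ψ) (y : Y → P)
    (hy : Continuous y) (s₀ : ℝ) {S : Set Y} (hS : IsCompact S) {U : Set ℝ} (hU : U ∈ 𝓝 s₀) (h0 : ∀ t ∉ S, ∀ s ∈ U, Ψ (y t, s) = 0) (n : ℕ) :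
    iteratedDeriv n (fun s : ℝ => ∫ t, Ψ (y t, s) ∂μ) s₀ = ∫ t, iteratedDeriv n (fun s : ℝ => Ψ (y t, s)) s₀ ∂μ := by
  -- a smooth compactly supported cutoff `χ = 1` near `s₀` with `tsupport χ ⊆ U`
  obtain ⟨ε, hε, hεU⟩ : ∃ ε > 0, Metric.closedBall s₀ ε ⊆ U := Metric.nhds_basis_closedBall.mem_iff.1 hU
  let bump : ContDiffBump s₀ := ⟨ε / 2, ε, half_pos hε, half_lt_self hε⟩
  set χ : ℝ → ℝ := fun s => bump s with hχ
  have hχd : ContDiff ℝ ∞ χ := bump.contDiff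
  have hχc : HasCompactSupport χ := bump.hasCompactSupport
  have hχ1 : ∀ᶠ s in 𝓝 s₀, χ s = 1 :=
    Filter.eventually_of_mem (Metric.closedBall_mem_nhds s₀ (half_pos hε)) fun s hs => bump.one_of_mem_closedBall hs
  have hχU : ∀ s, χ s ≠ 0 → s ∈ U := fun s hs =>
    hεU (bump.tsupport_eq ▸ subset_tsupport _ (Function.mem_support.2 hs))
  -- the cut integrand in the affine presentation `Ψχ (L s + c t)`
  set Ψχ : P × ℝ → F := fun q => χ q.2 • Ψ q with hΨχ
  have hΨχd : ContDiff ℝ ∞ Ψχ := (hχd.comp contDiff_snd).smul hΨ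
  set L : ℝ →L[ℝ] P × ℝ := ContinuousLinearMap.inr ℝ P ℝ with hL
  set c : Y → P × ℝ := fun t => (y t, 0) with hc
  have hcc : Continuous c := hy.prodMk continuous_const
  have hLc : ∀ t s, L s + c t = (y t, s) := fun t s => by
    rw [hL, hc, ContinuousLinearMap.inr_apply, Prod.mk_add_mk, zero_add, add_zero]
  set H : Y → ℝ → F := fun t s => Ψχ (L s + c t) with hH
  have hHeq : ∀ t, H t = fun s => χ s • Ψ (y t, s) := fun t => by funext s; rw [hH]; simp only [hΨχ, hLc]
  -- off `S` the cut integrand vanishes identically, hence so do all its derivatives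
  have hHS : ∀ t ∉ S, H t = 0 := by
    intro t ht; rw [hHeq t]; funext s
    by_cases hs : χ s = 0
    · rw [hs, zero_smul, Pi.zero_apply]
    · rw [h0 t ht s (hχU s hs), smul_zero, Pi.zero_apply]
  have hDS : ∀ (k : ℕ) (t : Y), t ∉ S → ∀ s, iteratedFDeriv ℝ k (H t) s = 0 := by
    intro k t ht s; rw [hHS t ht]; simp
  -- Hörmander's hypotheses
  have h1 : ∀ t, ContDiff ℝ ∞ (H t) := fun t => hΨχd.comp ((L.contDiff).add contDiff_const)
  have h2 : ∀ (k : ℕ) (s : ℝ), AEStronglyMeasurable (fun t => iteratedFDeriv ℝ k (H t) s) μ := fun k s =>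
    ((continuous_iteratedFDeriv_comp_affine_param hΨχd L hcc k s).stronglyMeasurable_of_hasCompactSupport
      (HasCompactSupport.intro hS fun t ht => hDS k t ht s)).aestronglyMeasurable
  have h3 : ∀ k : ℕ, ∃ g : Y → ℝ, Integrable g μ ∧ ∀ t s, ‖iteratedFDeriv ℝ k (H t) s‖ ≤ g t := by
    intro k
    have hjc : Continuous fun q : Y × ℝ => iteratedFDeriv ℝ k (fun s => Ψχ (L s + c q.1)) q.2 := continuous_iteratedFDeriv_comp_affine hΨχd L hcc k
    obtain ⟨B, hB⟩ := (hS.prod hχc.isCompact).exists_bound_of_continuousOn (f := fun q : Y × ℝ => iteratedFDeriv ℝ k (fun s => Ψχ (L s + c q.1)) q.2) hjc.continuousOn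
    refine ⟨S.indicator fun _ => max B 0, ?_, fun t s => ?_⟩
    · exact (integrableOn_const (hS.measure_lt_top (μ := μ)).ne).integrable_indicator hS.measurableSet
    by_cases ht : t ∈ S
    · rw [Set.indicator_of_mem ht]
      by_cases hs : s ∈ tsupport χ
      · exact (hB (t, s) ⟨ht, hs⟩).trans (le_max_left _ _)
      · have hsupp : tsupport (H t) ⊆ tsupport χ := by rw [hHeq t]; exact tsupport_smul_subset_left _ _
        have h0' : iteratedFDeriv ℝ k (H t) s = 0 := by
          by_contra hne
          exact hs (hsupp (support_iteratedFDeriv_subset k (Function.mem_support.2 hne)))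
        rw [h0', norm_zero]; exact le_max_right _ _
    · rw [Set.indicator_of_notMem ht, hDS k t ht s, norm_zero]
  -- Hörmander: the cut integral's iterated derivatives are the integrals of the cut integrand's
  have hkey := iteratedFDeriv_integral_eq (μ := μ) h1 h2 h3 n s₀
  -- near `s₀` the cut integral is the integral, and the cut integrand is the integrand
  have hint : (fun s : ℝ => ∫ t, Ψ (y t, s) ∂μ) =ᶠ[𝓝 s₀] fun s => ∫ t, H t s ∂μ := by
    filter_upwards [hχ1] with s hs1
    refine integral_congr_ae (Eventually.of_forall fun t => ?_)
    simp only [hH, hΨχ, hLc, hs1, one_smul]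
  have hpt : ∀ t, (fun s : ℝ => Ψ (y t, s)) =ᶠ[𝓝 s₀] H t := fun t => by
    filter_upwards [hχ1] with s hs1
    simp only [hH, hΨχ, hLc, hs1, one_smul]
  -- integrability of the multilinear integrand (domination)
  have hintD : Integrable (fun t => iteratedFDeriv ℝ n (H t) s₀) μ := by
    obtain ⟨g, hg, hgb⟩ := h3 n
    exact Integrable.mono' hg (h2 n s₀) (Eventually.of_forall fun t => hgb t s₀)
  rw [hint.iteratedDeriv_eq n, iteratedDeriv_eq_iteratedFDeriv, hkey, ContinuousMultilinearMap.integral_apply hintD]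
  refine integral_congr_ae (Eventually.of_forall fun t => ?_)
  show (iteratedFDeriv ℝ n (H t) s₀) (fun _ => 1) = iteratedDeriv n (fun s => Ψ (y t, s)) s₀
  rw [iteratedDeriv_eq_iteratedFDeriv, ((hpt t).iteratedFDeriv ℝ n).eq_of_nhds]

end Generic

end Literature.Analysis.Calculus

/-! ## §1 Derivatives under the integral along a line of angles, through compact walls; conjugated curves -/

namespace Literature.NumberTheory.Automorphic.UnitaryGroup

open Literature.Analysis.Calculus
open scoped Matrix MatrixGroups
open scoped Matrix.Norms.Operator

section Lines

variable (L : Type) [Field L] (N : ℕ) (α : Fin N → L) (w : {w : InfinitePlace L // IsComplex w})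
  {E : Type*} [NormedAddCommGroup E] [NormedSpace ℝ E] [CompleteSpace E]
  [MeasurableSpace (archLocal L N (Matrix.diagonal α) w)] [BorelSpace (archLocal L N (Matrix.diagonal α) w)]

/-- **DERIVATIVES OF THE TORUS ORBITAL FUNCTION ALONG A LINE OF ANGLES PASS UNDER THE INTEGRAL, TO EVERY ORDER, ON THE BLOCK-SEPARATED SET** (`b` a constant-sign labelling, `θ₀`
block-separated — coincidences inside blocks allowed, i.e. THROUGH every compact wall): `∂ⁿ_y|₀ ∫_{G_w} Θ(g·diag(ζe^{i(θ₀+yv)})·g⁻¹) dν = ∫_{G_w} ∂ⁿ_y|₀ Θ(g·diag(ζe^{i(θ₀+yv)})·g⁻¹) dν` for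
every direction `v` (§0 with the jointly smooth integrand of ★ (A1) and the UNIFORM compact support of ★ `exists_closedBall_isCompact_apply_conj_circleDiagonal_angles_eq_zero_of_blocks`).
[cite: Rogawski1990, §8.2 pp. 122–123; §8.4 p. 126] [cite: Varadarajan1989, §2.4 Thm. 8] [cite: HormanderALPDO1, Thm. 1.1.9] -/
theorem iteratedDeriv_integral_comp_conj_circleDiagonal_line_eq (hα : ∀ i, α i ≠ 0) (hreal : ∀ i, (w.1.embedding (α i)).im = 0)
    {ι : Type*} (b : Fin N → ι) (hsign : ∀ i j, i ≠ j → b i = b j → 0 < (w.1.embedding (α i)).re * (w.1.embedding (α j)).re)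
    (ν : Measure (archLocal L N (Matrix.diagonal α) w)) [IsFiniteMeasureOnCompacts ν]
    (Θ : Matrix (Fin N) (Fin N) ℂ → E) (hΘ : ContDiff ℝ ∞ Θ) (hfc : HasCompactSupport fun k : archLocal L N (Matrix.diagonal α) w => Θ (((k : GL (Fin N) ℂ) : Matrix (Fin N) (Fin N) ℂ)))
    (ζ : Fin N → Circle) (θ₀ : Fin N → ℝ) (hθ₀ : ∀ i j, b i ≠ b j → ζ i * Circle.exp (θ₀ i) ≠ ζ j * Circle.exp (θ₀ j)) (v : Fin N → ℝ) (n : ℕ) :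
    iteratedDeriv n (fun y : ℝ => ∫ g : archLocal L N (Matrix.diagonal α) w,
        Θ ((((g * ⟨circleDiagonal N fun i => ζ i * Circle.exp (θ₀ i + y * v i), circleDiagonal_mem_archLocal_diagonal L N α w _⟩ * g⁻¹ :
          archLocal L N (Matrix.diagonal α) w) : GL (Fin N) ℂ) : Matrix (Fin N) (Fin N) ℂ)) ∂ν) 0 =
      ∫ g : archLocal L N (Matrix.diagonal α) w, iteratedDeriv n (fun y : ℝ =>
        Θ ((((g * ⟨circleDiagonal N fun i => ζ i * Circle.exp (θ₀ i + y * v i), circleDiagonal_mem_archLocal_diagonal L N α w _⟩ * g⁻¹ :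
          archLocal L N (Matrix.diagonal α) w) : GL (Fin N) ℂ) : Matrix (Fin N) (Fin N) ℂ))) 0 ∂ν := by
  -- the jointly smooth integrand in `(A, B, y)` and the continuous parameter map `g ↦ (g, g⁻¹)`
  have hline : ContDiff ℝ ∞ fun y : ℝ => fun i => θ₀ i + y * v i :=
    contDiff_pi.2 fun i => contDiff_const.add (contDiff_id.mul contDiff_const)
  set Ψ : (Matrix (Fin N) (Fin N) ℂ × Matrix (Fin N) (Fin N) ℂ) × ℝ → E :=
    fun q => Θ (q.1.1 * ((circleDiagonal N fun i => ζ i * Circle.exp (θ₀ i + q.2 * v i) : GL (Fin N) ℂ) : Matrix (Fin N) (Fin N) ℂ) * q.1.2) with hΨ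
  have hΨd : ContDiff ℝ ∞ Ψ :=
    hΘ.comp (((contDiff_fst.comp contDiff_fst).mul (((contDiff_coe_circleDiagonal_angles N ζ).comp hline).comp contDiff_snd)).mul (contDiff_snd.comp contDiff_fst))
  set y : archLocal L N (Matrix.diagonal α) w → Matrix (Fin N) (Fin N) ℂ × Matrix (Fin N) (Fin N) ℂ :=
    fun g => (((g : GL (Fin N) ℂ) : Matrix (Fin N) (Fin N) ℂ), (((g⁻¹ : archLocal L N (Matrix.diagonal α) w) : GL (Fin N) ℂ) : Matrix (Fin N) (Fin N) ℂ)) with hy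
  have hyc : Continuous y :=
    (Units.continuous_val.comp continuous_subtype_val).prodMk ((Units.continuous_val.comp continuous_subtype_val).comp continuous_inv)
  have hΨy : ∀ (g : archLocal L N (Matrix.diagonal α) w) (s : ℝ), Ψ (y g, s) =
      Θ ((((g * ⟨circleDiagonal N fun i => ζ i * Circle.exp (θ₀ i + s * v i), circleDiagonal_mem_archLocal_diagonal L N α w _⟩ * g⁻¹ :
        archLocal L N (Matrix.diagonal α) w) : GL (Fin N) ℂ) : Matrix (Fin N) (Fin N) ℂ)) := fun g s => by
    simp only [hΨ, hy, coe_conj_archLocal]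
  -- the uniform compact support near `θ₀`, pulled back along the line
  obtain ⟨δ, hδ, S, hS, hS0⟩ := exists_closedBall_isCompact_apply_conj_circleDiagonal_angles_eq_zero_of_blocks L N α w hα hreal b hsign Θ hfc ζ θ₀ hθ₀
  have hlc : Continuous fun s : ℝ => fun i => θ₀ i + s * v i := hline.continuous
  have hU : (fun s : ℝ => fun i => θ₀ i + s * v i) ⁻¹' Metric.closedBall θ₀ δ ∈ 𝓝 (0 : ℝ) := by
    refine hlc.continuousAt.preimage_mem_nhds ?_
    have h00 : (fun i => θ₀ i + (0 : ℝ) * v i) = θ₀ := funext fun i => by rw [zero_mul, add_zero]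
    rw [h00]
    exact Metric.closedBall_mem_nhds θ₀ hδ
  have key := iteratedDeriv_integral_comp_of_contDiff_of_support ν Ψ hΨd y hyc 0 hS hU
    (fun g hg s hs => by rw [hΨy]; exact hS0 g hg _ hs) n
  simp only [hΨy] at key
  exact key

/-- **CONJUGATING THE WHOLE CURVE BY A FIXED `u ∈ G_w` DOES NOT CHANGE THE DERIVATIVES OF THE INTEGRAND'S INTEGRAL**: `∫ ∂ⁿ_y|₀ Θ(g·(u t_y u⁻¹)·g⁻¹) dν = ∫ ∂ⁿ_y|₀ Θ(g·t_y·g⁻¹) dν`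
(`t_y = diag(ζe^{i(θ₀+yv)})`, `ν` right-invariant).  For `u` in the centraliser `M` of the base point `t₀ = diag(ζe^{iθ₀})` (a compact-wall point: `M ⊇ T` compact non-abelian) the curves
`u t_y u⁻¹ = t₀·(u c(y) u⁻¹)` are the torus curve transported to EVERY transversal direction `Ad(u)·v` inside `M` — «all transversal derivatives at a compact-wall point equal the normal one»
(both sides are `∂ⁿ_y|₀` of the same function of `y` by ★ `integral_comp_conj_conj`, and §0 on each side). [cite: Rogawski1990, §8.2 pp. 122–123; §8.4 p. 126] [cite: HormanderALPDO1, Thm. 1.1.9] -/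
theorem integral_iteratedDeriv_comp_conj_conj_circleDiagonal_line_eq (hα : ∀ i, α i ≠ 0) (hreal : ∀ i, (w.1.embedding (α i)).im = 0)
    {ι : Type*} (b : Fin N → ι) (hsign : ∀ i j, i ≠ j → b i = b j → 0 < (w.1.embedding (α i)).re * (w.1.embedding (α j)).re)
    (ν : Measure (archLocal L N (Matrix.diagonal α) w)) [IsFiniteMeasureOnCompacts ν] [ν.IsMulRightInvariant]
    (Θ : Matrix (Fin N) (Fin N) ℂ → E) (hΘ : ContDiff ℝ ∞ Θ) (hfc : HasCompactSupport fun k : archLocal L N (Matrix.diagonal α) w => Θ (((k : GL (Fin N) ℂ) : Matrix (Fin N) (Fin N) ℂ)))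
    (ζ : Fin N → Circle) (θ₀ : Fin N → ℝ) (hθ₀ : ∀ i j, b i ≠ b j → ζ i * Circle.exp (θ₀ i) ≠ ζ j * Circle.exp (θ₀ j)) (v : Fin N → ℝ) (n : ℕ)
    (u : archLocal L N (Matrix.diagonal α) w) :
    ∫ g : archLocal L N (Matrix.diagonal α) w, iteratedDeriv n (fun y : ℝ =>
        Θ ((((g * (u * ⟨circleDiagonal N fun i => ζ i * Circle.exp (θ₀ i + y * v i), circleDiagonal_mem_archLocal_diagonal L N α w _⟩ * u⁻¹) * g⁻¹ :
          archLocal L N (Matrix.diagonal α) w) : GL (Fin N) ℂ) : Matrix (Fin N) (Fin N) ℂ))) 0 ∂ν =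
      ∫ g : archLocal L N (Matrix.diagonal α) w, iteratedDeriv n (fun y : ℝ =>
        Θ ((((g * ⟨circleDiagonal N fun i => ζ i * Circle.exp (θ₀ i + y * v i), circleDiagonal_mem_archLocal_diagonal L N α w _⟩ * g⁻¹ :
          archLocal L N (Matrix.diagonal α) w) : GL (Fin N) ℂ) : Matrix (Fin N) (Fin N) ℂ))) 0 ∂ν := by
  -- the conjugated side: the same §0 computation with the parameter map `g ↦ (g u, u⁻¹ g⁻¹)` and the support translated by `u⁻¹`
  have hline : ContDiff ℝ ∞ fun y : ℝ => fun i => θ₀ i + y * v i :=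
    contDiff_pi.2 fun i => contDiff_const.add (contDiff_id.mul contDiff_const)
  set Ψ : (Matrix (Fin N) (Fin N) ℂ × Matrix (Fin N) (Fin N) ℂ) × ℝ → E :=
    fun q => Θ (q.1.1 * ((circleDiagonal N fun i => ζ i * Circle.exp (θ₀ i + q.2 * v i) : GL (Fin N) ℂ) : Matrix (Fin N) (Fin N) ℂ) * q.1.2) with hΨ
  have hΨd : ContDiff ℝ ∞ Ψ :=
    hΘ.comp (((contDiff_fst.comp contDiff_fst).mul (((contDiff_coe_circleDiagonal_angles N ζ).comp hline).comp contDiff_snd)).mul (contDiff_snd.comp contDiff_fst))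
  set yu : archLocal L N (Matrix.diagonal α) w → Matrix (Fin N) (Fin N) ℂ × Matrix (Fin N) (Fin N) ℂ :=
    fun g => ((((g * u : archLocal L N (Matrix.diagonal α) w) : GL (Fin N) ℂ) : Matrix (Fin N) (Fin N) ℂ),
      ((((g * u)⁻¹ : archLocal L N (Matrix.diagonal α) w) : GL (Fin N) ℂ) : Matrix (Fin N) (Fin N) ℂ)) with hyu
  have hyuc : Continuous yu :=
    ((Units.continuous_val.comp continuous_subtype_val).comp (continuous_id.mul continuous_const)).prodMk
      (((Units.continuous_val.comp continuous_subtype_val).comp continuous_inv).comp (continuous_id.mul continuous_const))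
  have hconj : ∀ (g : archLocal L N (Matrix.diagonal α) w) (s : ℝ),
      g * (u * ⟨circleDiagonal N fun i => ζ i * Circle.exp (θ₀ i + s * v i), circleDiagonal_mem_archLocal_diagonal L N α w _⟩ * u⁻¹) * g⁻¹ =
        (g * u) * ⟨circleDiagonal N fun i => ζ i * Circle.exp (θ₀ i + s * v i), circleDiagonal_mem_archLocal_diagonal L N α w _⟩ * (g * u)⁻¹ := fun g s => by
    rw [_root_.mul_inv_rev]; group
  have hΨyu : ∀ (g : archLocal L N (Matrix.diagonal α) w) (s : ℝ), Ψ (yu g, s) =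
      Θ ((((g * (u * ⟨circleDiagonal N fun i => ζ i * Circle.exp (θ₀ i + s * v i), circleDiagonal_mem_archLocal_diagonal L N α w _⟩ * u⁻¹) * g⁻¹ :
        archLocal L N (Matrix.diagonal α) w) : GL (Fin N) ℂ) : Matrix (Fin N) (Fin N) ℂ)) := fun g s => by
    rw [hconj]
    simp only [hΨ, hyu, coe_conj_archLocal]
  obtain ⟨δ, hδ, S, hS, hS0⟩ := exists_closedBall_isCompact_apply_conj_circleDiagonal_angles_eq_zero_of_blocks L N α w hα hreal b hsign Θ hfc ζ θ₀ hθ₀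
  have hlc : Continuous fun s : ℝ => fun i => θ₀ i + s * v i := hline.continuous
  have hU : (fun s : ℝ => fun i => θ₀ i + s * v i) ⁻¹' Metric.closedBall θ₀ δ ∈ 𝓝 (0 : ℝ) := by
    refine hlc.continuousAt.preimage_mem_nhds ?_
    have h00 : (fun i => θ₀ i + (0 : ℝ) * v i) = θ₀ := funext fun i => by rw [zero_mul, add_zero]
    rw [h00]
    exact Metric.closedBall_mem_nhds θ₀ hδ
  -- the translated compact `S·u⁻¹` carries the support of the conjugated integrand
  have hSu : IsCompact ((fun g : archLocal L N (Matrix.diagonal α) w => g * u⁻¹) '' S) := hS.image (continuous_id.mul continuous_const)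
  have key := iteratedDeriv_integral_comp_of_contDiff_of_support ν Ψ hΨd yu hyuc 0 hSu hU
    (fun g hg s hs => by
      rw [hΨyu, hconj]
      refine hS0 (g * u) (fun hgu => hg ⟨g * u, hgu, by simp only [mul_inv_cancel_right]⟩) _ hs) n
  simp only [hΨyu] at key
  rw [← key]
  -- the two integrals agree for every `y` (★ `integral_comp_conj_conj`), hence so do their derivatives at `0`
  have heq : (fun y : ℝ => ∫ g : archLocal L N (Matrix.diagonal α) w,
      Θ ((((g * (u * ⟨circleDiagonal N fun i => ζ i * Circle.exp (θ₀ i + y * v i), circleDiagonal_mem_archLocal_diagonal L N α w _⟩ * u⁻¹) * g⁻¹ :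
        archLocal L N (Matrix.diagonal α) w) : GL (Fin N) ℂ) : Matrix (Fin N) (Fin N) ℂ)) ∂ν) =
      fun y : ℝ => ∫ g : archLocal L N (Matrix.diagonal α) w,
        Θ ((((g * ⟨circleDiagonal N fun i => ζ i * Circle.exp (θ₀ i + y * v i), circleDiagonal_mem_archLocal_diagonal L N α w _⟩ * g⁻¹ :
          archLocal L N (Matrix.diagonal α) w) : GL (Fin N) ℂ) : Matrix (Fin N) (Fin N) ℂ)) ∂ν := by
    funext y
    exact integral_comp_conj_conj ν u _ (fun k : archLocal L N (Matrix.diagonal α) w => Θ (((k : GL (Fin N) ℂ) : Matrix (Fin N) (Fin N) ℂ)))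
  rw [heq]
  exact iteratedDeriv_integral_comp_conj_circleDiagonal_line_eq L N α w hα hreal b hsign ν Θ hΘ hfc ζ θ₀ hθ₀ v n

end Lines

/-! ## §2 Evenness across a compact wall: odd normal derivatives vanish -/

section Wall

variable (L : Type) [Field L] (N : ℕ) (α : Fin N → L) (w : {w : InfinitePlace L // IsComplex w})
  {E : Type*} [NormedAddCommGroup E] [NormedSpace ℝ E]
  [MeasurableSpace (archLocal L N (Matrix.diagonal α) w)] [BorelSpace (archLocal L N (Matrix.diagonal α) w)]

/-- The normal line through a wall point, reflected: `(ζ_k e^{i(−y)(δ_i−δ_j)_k})_k = (ζ_k e^{iy(δ_i−δ_j)_k})_{k ∘ (i j)}` when `ζ_i = ζ_j`. [cite: BrockerTomDieck1985, Ch. IV (3.2)] -/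
theorem circleDiagonal_wallLine_neg_eq_comp_swap {i j : Fin N} (hij : i ≠ j) (ζ : Fin N → Circle) (hζ : ζ i = ζ j) (y : ℝ) :
    (fun k => ζ k * Circle.exp ((-y) * ((if k = i then 1 else 0) - (if k = j then 1 else 0)))) =
      (fun k => ζ k * Circle.exp (y * ((if k = i then 1 else 0) - (if k = j then 1 else 0)))) ∘ Equiv.swap i j := by
  funext k
  simp only [Function.comp_apply]
  by_cases hki : k = i
  · subst hki
    rw [Equiv.swap_apply_left, if_pos rfl, if_neg hij, if_neg (Ne.symm hij), if_pos rfl, hζ]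
    congr 1
    congr 1
    ring
  · by_cases hkj : k = j
    · subst hkj
      rw [Equiv.swap_apply_right, if_neg hki, if_pos rfl, if_pos rfl, if_neg hij, ← hζ]
      congr 1
      congr 1
      ring
    · rw [Equiv.swap_apply_of_ne_of_ne hki hkj, if_neg hki, if_neg hkj]
      congr 1
      congr 1
      ring

/-- **EVENNESS OF THE TORUS ORBITAL FUNCTION ACROSS A COMPACT WALL**: at a wall point (`ζ_i = ζ_j`, the pair `(i, j)` COMPACT: `e_i e_j > 0`), for EVERY `Θ` and every right-invariant `ν`,
`∫ Θ(g·diag(ζe^{−iy(δ_i−δ_j)})·g⁻¹) dν = ∫ Θ(g·diag(ζe^{iy(δ_i−δ_j)})·g⁻¹) dν` — the sign-preserving transposition `(i j)` is a Weyl move of `G_w` (★ `integral_comp_conj_circleDiagonal_comp_perm`).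
[cite: Rogawski1990, §8.2 p. 122] [cite: BrockerTomDieck1985, Ch. IV (3.2)] -/
theorem integral_comp_conj_circleDiagonal_wallLine_neg (hα : ∀ i, α i ≠ 0) (hreal : ∀ i, (w.1.embedding (α i)).im = 0)
    {i j : Fin N} (hij : i ≠ j) (hcpt : 0 < (w.1.embedding (α i)).re * (w.1.embedding (α j)).re) (ζ : Fin N → Circle) (hζ : ζ i = ζ j)
    (ν : Measure (archLocal L N (Matrix.diagonal α) w)) [ν.IsMulRightInvariant] (f : archLocal L N (Matrix.diagonal α) w → E) (y : ℝ) :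
    ∫ g, f (g * ⟨circleDiagonal N fun k => ζ k * Circle.exp ((-y) * ((if k = i then 1 else 0) - (if k = j then 1 else 0))),
        circleDiagonal_mem_archLocal_diagonal L N α w _⟩ * g⁻¹) ∂ν =
      ∫ g, f (g * ⟨circleDiagonal N fun k => ζ k * Circle.exp (y * ((if k = i then 1 else 0) - (if k = j then 1 else 0))),
        circleDiagonal_mem_archLocal_diagonal L N α w _⟩ * g⁻¹) ∂ν := by
  have hsign : ∀ k, 0 < (w.1.embedding (α (Equiv.swap i j k))).re ↔ 0 < (w.1.embedding (α k)).re := by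
    intro k
    have hij' : 0 < (w.1.embedding (α i)).re ↔ 0 < (w.1.embedding (α j)).re := by
      rcases mul_pos_iff.1 hcpt with ⟨hi, hj⟩ | ⟨hi, hj⟩
      · exact ⟨fun _ => hj, fun _ => hi⟩
      · exact ⟨fun h => absurd h (not_lt.2 hi.le), fun h => absurd h (not_lt.2 hj.le)⟩
    by_cases hki : k = i
    · subst hki; rw [Equiv.swap_apply_left]; exact hij'.symm
    · by_cases hkj : k = j
      · subst hkj; rw [Equiv.swap_apply_right]; exact hij'
      · rw [Equiv.swap_apply_of_ne_of_ne hki hkj]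
  have h := integral_comp_conj_circleDiagonal_comp_perm L N α w hα hreal hsign
    (fun k => ζ k * Circle.exp (y * ((if k = i then 1 else 0) - (if k = j then 1 else 0)))) ν f
  have hpt : (fun k => ζ k * Circle.exp ((-y) * ((if k = i then 1 else 0) - (if k = j then 1 else 0)))) =
      (fun k => ζ k * Circle.exp (y * ((if k = i then 1 else 0) - (if k = j then 1 else 0)))) ∘ Equiv.swap i j :=
    circleDiagonal_wallLine_neg_eq_comp_swap N hij ζ hζ y
  simp only [hpt]
  exact h

/-- **EVERY ODD NORMAL DERIVATIVE OF THE TORUS ORBITAL FUNCTION VANISHES AT A COMPACT WALL** (`NΦ|_{wall} = N³Φ|_{wall} = 0` for `n = 1, 3`): the function of `y` is even (previous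
theorem), and `∂ⁿ|₀` of an even function is `(−1)ⁿ ∂ⁿ|₀` (Mathlib `iteratedDeriv_comp_neg`). No smoothness is needed. [cite: Rogawski1990, §8.2 p. 122; §8.4 p. 126] -/
theorem iteratedDeriv_integral_comp_conj_circleDiagonal_wallLine_eq_zero_of_odd (hα : ∀ i, α i ≠ 0) (hreal : ∀ i, (w.1.embedding (α i)).im = 0)
    {i j : Fin N} (hij : i ≠ j) (hcpt : 0 < (w.1.embedding (α i)).re * (w.1.embedding (α j)).re) (ζ : Fin N → Circle) (hζ : ζ i = ζ j)
    (ν : Measure (archLocal L N (Matrix.diagonal α) w)) [ν.IsMulRightInvariant] (f : archLocal L N (Matrix.diagonal α) w → E) {n : ℕ} (hn : Odd n) :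
    iteratedDeriv n (fun y : ℝ => ∫ g, f (g * ⟨circleDiagonal N fun k => ζ k * Circle.exp (y * ((if k = i then 1 else 0) - (if k = j then 1 else 0))),
        circleDiagonal_mem_archLocal_diagonal L N α w _⟩ * g⁻¹) ∂ν) 0 = 0 := by
  set Φ : ℝ → E := fun y : ℝ => ∫ g, f (g * ⟨circleDiagonal N fun k => ζ k * Circle.exp (y * ((if k = i then 1 else 0) - (if k = j then 1 else 0))),
        circleDiagonal_mem_archLocal_diagonal L N α w _⟩ * g⁻¹) ∂ν with hΦ
  have heven : (fun y => Φ (-y)) = Φ := by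
    funext y
    simp only [hΦ]
    exact integral_comp_conj_circleDiagonal_wallLine_neg L N α w hα hreal hij hcpt ζ hζ ν f y
  have h := iteratedDeriv_comp_neg n Φ 0
  rw [heven, neg_zero, hn.neg_one_pow, neg_one_smul] at h
  -- `x = -x` in a real vector space forces `x = 0`
  have h2 : (2 : ℝ) • iteratedDeriv n Φ 0 = 0 := by rw [two_smul]; nth_rewrite 1 [h]; rw [neg_add_cancel]
  exact (smul_eq_zero.1 h2).resolve_left two_ne_zero

end Wall

/-! ## §3 The second normal derivative at a compact wall: under the integral, and along every conjugate transversal curve -/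

section WallTwo

variable (L : Type) [Field L] (N : ℕ) (α : Fin N → L) (w : {w : InfinitePlace L // IsComplex w})
  {E : Type*} [NormedAddCommGroup E] [NormedSpace ℝ E] [CompleteSpace E]
  [MeasurableSpace (archLocal L N (Matrix.diagonal α) w)] [BorelSpace (archLocal L N (Matrix.diagonal α) w)]

/-- **`N²Φ|_{wall}` UNDER THE INTEGRAL, AND ALONG EVERY CONJUGATE OF THE NORMAL CURVE**: at a compact-wall point `t₀ = diag ζ` (`ζ_i = ζ_j`, `e_i e_j > 0`, `ζ` block-separated for a
constant-sign labelling `b` with `b i = b j`), for every `u ∈ G_w` and every right-invariant `ν` finite on compacts,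
`∂²_y|₀ ∫ Θ(g·diag(ζe^{iy(δ_i−δ_j)})·g⁻¹) dν = ∫ ∂²_y|₀ Θ(g·(u·diag(ζe^{iy(δ_i−δ_j)})·u⁻¹)·g⁻¹) dν` — for `u ∈ Z(t₀) ≅ U(2)×(S¹)^{N−2}` the right side differentiates along the
transversal direction `Ad(u)(δ_i−δ_j)` of the compact centraliser: «all transversal second derivatives at the wall are the normal one», with NO Casimir∕radial-component theory
(§1 twice). Averaging the right side over `u ∈ Z(t₀)` turns the integrand into a class function on the singular orbit `G_w·t₀` — the input shape of ROAD A (A3). [cite: Rogawski1990, §8.2 pp. 122–123; §8.4 p. 126]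
[cite: HormanderALPDO1, Thm. 1.1.9] -/
theorem iteratedDeriv_two_integral_comp_conj_circleDiagonal_wallLine_eq_integral_conj (hα : ∀ i, α i ≠ 0) (hreal : ∀ i, (w.1.embedding (α i)).im = 0)
    {ι : Type*} (b : Fin N → ι) (hsign : ∀ i j, i ≠ j → b i = b j → 0 < (w.1.embedding (α i)).re * (w.1.embedding (α j)).re)
    (ν : Measure (archLocal L N (Matrix.diagonal α) w)) [IsFiniteMeasureOnCompacts ν] [ν.IsMulRightInvariant]
    (Θ : Matrix (Fin N) (Fin N) ℂ → E) (hΘ : ContDiff ℝ ∞ Θ) (hfc : HasCompactSupport fun k : archLocal L N (Matrix.diagonal α) w => Θ (((k : GL (Fin N) ℂ) : Matrix (Fin N) (Fin N) ℂ)))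
    (ζ : Fin N → Circle) (hζ : ∀ k l, b k ≠ b l → ζ k ≠ ζ l) (i j : Fin N) (u : archLocal L N (Matrix.diagonal α) w) :
    iteratedDeriv 2 (fun y : ℝ => ∫ g : archLocal L N (Matrix.diagonal α) w,
        Θ ((((g * ⟨circleDiagonal N fun k => ζ k * Circle.exp (y * ((if k = i then 1 else 0) - (if k = j then 1 else 0))),
          circleDiagonal_mem_archLocal_diagonal L N α w _⟩ * g⁻¹ : archLocal L N (Matrix.diagonal α) w) : GL (Fin N) ℂ) : Matrix (Fin N) (Fin N) ℂ)) ∂ν) 0 =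
      ∫ g : archLocal L N (Matrix.diagonal α) w, iteratedDeriv 2 (fun y : ℝ =>
        Θ ((((g * (u * ⟨circleDiagonal N fun k => ζ k * Circle.exp (y * ((if k = i then 1 else 0) - (if k = j then 1 else 0))),
          circleDiagonal_mem_archLocal_diagonal L N α w _⟩ * u⁻¹) * g⁻¹ : archLocal L N (Matrix.diagonal α) w) : GL (Fin N) ℂ) : Matrix (Fin N) (Fin N) ℂ))) 0 ∂ν := by
  -- the wall line is the line `θ₀ + y v` with `θ₀ = 0`, `v = δ_i − δ_j`
  have hθ₀ : ∀ k l, b k ≠ b l → ζ k * Circle.exp ((0 : Fin N → ℝ) k) ≠ ζ l * Circle.exp ((0 : Fin N → ℝ) l) := by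
    intro k l hkl
    simpa only [Pi.zero_apply, Circle.exp_zero, mul_one] using hζ k l hkl
  have e1 := iteratedDeriv_integral_comp_conj_circleDiagonal_line_eq L N α w hα hreal b hsign ν Θ hΘ hfc ζ 0 hθ₀
    (fun k => (if k = i then 1 else 0) - (if k = j then 1 else 0)) 2
  have e2 := integral_iteratedDeriv_comp_conj_conj_circleDiagonal_line_eq L N α w hα hreal b hsign ν Θ hΘ hfc ζ 0 hθ₀
    (fun k => (if k = i then 1 else 0) - (if k = j then 1 else 0)) 2 u
  simp only [Pi.zero_apply, zero_add] at e1 e2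
  rw [e1, e2]

end WallTwo

end Literature.NumberTheory.Automorphic.UnitaryGroup

end
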